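import Literature.NumberTheory.Sieve.AsymptoticSieveForPrimesTheorem2Tails
import HarnessLib

/-!
# Asymptotic sieve for primes, Theorem 2: the level of distribution of `μ²a` at a fixed `x` (FI (9.7), (9.12) before the choice of parameters)

Topic `Literature/NumberTheory/Sieve` (trunk T-SIEVE), sequel of `…Theorem2Tails`. Source: J. Friedlander,
H. Iwaniec, *Asymptotic sieve for primes*, Ann. of Math. 148 (1998) 1041–1065 [FriedlanderIwaniecASP1998]
(= arXiv:math/9811186), §9 pp. 1061–1062: (9.7) `R(t,D) = ∑♭_{d≤D} |r̃_d(t)| ≤ Ã(x)(log x)^{-2^{22}}`,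
"`R(t,D) ≪ E log x` … `E₁` … `E₂ = E₂₁ + E₂₂ + …`", and (9.12) `Ã(x) = GA(x){1 + O((log x)⁻¹)}`
("along the above lines we have, by (9.10), also proved (9.12)").

For a general sifted sequence `A` and fixed `x ≥ 1`, `t ≤ x`, truncation `Λ` and level `D₀ ≤ ⌊x⌋`:

* `SieveSequence.moebiusSq_levelSum_le_struct` — summing the pointwise decomposition of `r̃_d`
  (`abs_moebiusSq_remainder_le`, `…Theorem2Identities`) over the squarefree `d ≤ D₀`:
  `∑_d |r̃_d(t)| ≤ (1 + ∑_d g̃(d)) · E(t)`, `E(t) = A_1(t) ∑_d TG_d + ∑_d RS_d(t) + ∑_d ES_d(t)`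
  (FI's "`R(t,D) ≪ E log x`"), and `|Ã(t) - G_X A_1(t)| ≤ E(t)` (the `d = 1` term, towards (9.12));
* `SieveSequence.moebiusSq_E_le` — the bound for `E(t)` obtained by inserting the estimates of
  `…Theorem2Tails`: with `D₀Λ² ≤ M`, `Λ₁² ≤ M`, `1 ≤ Λ`, `1 ≤ Λ₁`,
  `E(t) ≤ A(x)·e^{2KC}Λ^{-3/4} e^{∑_{p≤D₀} g(p)} + √((M₄ + A(x) E_g) R(t)) + √((A(x) e^{KC} Λ^{-3/4} + R(x)) M₃)
   + √((∑_{n≤t} a_n²) ⌊t⌋ V²/Λ₁)`,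
  where `R(u) = ∑_{b ≤ M cubefree} |r_b(u)|` (the cubefree level sum of (2.9)/(R₃)),
  `M_k = ∑_{n≤x} a_n 2^{kω(n)}` (moments, `…Theorem2Counting`), `E_g = ∑_{b≤M cubefree} 4^{ω(b)} g(b)`,
  `V ≥ ∑_{m ≤ ⌊t⌋} τ(m)³/m`, `C = ∑_n n^{-5/4}`.

The choice `Λ = (log x)^{2^{24}}`, `Λ₁ = Λ√D`, the insertion of (2.2), (2.7)–(2.9) and the deduction of
Theorem 2 / [FriedlanderIwaniecAnnals1998] Proposition 2.1 are in the sequel `…Theorem2`.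

## References

* J. Friedlander, H. Iwaniec, *Asymptotic sieve for primes*, Ann. of Math. 148 (1998), 1041–1065,
  §9 (9.7)–(9.12). [cite: FriedlanderIwaniecASP1998, §9 (9.7)-(9.12)]

## Mathlib / tree search

Everything used is in `…Theorem2Identities`, `…Theorem2Counting`, `…Theorem2Tails`;
`lean search 'levelSum_le_struct|moebiusSq_E_le'`: nothing before this file.
-/

noncomputable section

open Filter Finset Real
open scoped ArithmeticFunction.sigma

namespace Literature.NumberTheory.Sieve

namespace SieveSequence

variable (A : SieveSequence)

/-- **`R(t, D) ≤ (1 + ∑ g̃) · E`** (FI p. 1061, "`R(t,D) ≪ E log x`", structural form): for `x ≥ 1`,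
`t ≤ x`, `1 ≤ D₀ ≤ ⌊x⌋`, a truncation `Λ`, `T = {p ≤ ⌊x⌋}`, `𝒟 = {d ≤ D₀ squarefree}`:
`∑_{d ∈ 𝒟} |r̃_d(t)| ≤ (1 + ∑_{d∈𝒟} g̃(d)) · (A_1(t) ∑_d TG_d + ∑_d RS_d(t) + ∑_d ES_d(t))`.
[cite: FriedlanderIwaniecASP1998, §9 p. 1061] -/
theorem moebiusSq_levelSum_le_struct (hsize : ∀ t, A.size t = A.congrSum 1 t)
    (h24 : ∀ p : ℕ, p.Prime → 0 ≤ A.density (p ^ 2) ∧ A.density (p ^ 2) ≤ A.density p ∧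
      A.density p < 1)
    {x t : ℝ} (hx : 1 ≤ x) (htx : t ≤ x) {D₀ : ℕ} (hD₀1 : 1 ≤ D₀) (hD₀X : D₀ ≤ ⌊x⌋₊) (Λ : ℕ) :
    ∑ d ∈ (Icc 1 D₀).filter Squarefree, |A.moebiusSq.remainder d t| ≤
      (1 + ∑ d ∈ (Icc 1 D₀).filter Squarefree, moebiusSqDensity A.density d) *
        (A.congrSum 1 t * ∑ d ∈ (Icc 1 D₀).filter Squarefree,
            ∑ L ∈ (Nat.primesLE ⌊x⌋₊).powerset with ¬(∏ p ∈ L, p) ≤ Λ,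
              A.density (Nat.lcm d ((∏ p ∈ L, p) ^ 2)) +
          ∑ d ∈ (Icc 1 D₀).filter Squarefree,
            ∑ L ∈ (Nat.primesLE ⌊x⌋₊).powerset with (∏ p ∈ L, p) ≤ Λ,
              |A.remainder (Nat.lcm d ((∏ p ∈ L, p) ^ 2)) t| +
          ∑ d ∈ (Icc 1 D₀).filter Squarefree,
            ∑ L ∈ (Nat.primesLE ⌊x⌋₊).powerset with ¬(∏ p ∈ L, p) ≤ Λ,
              A.congrSum (Nat.lcm d ((∏ p ∈ L, p) ^ 2)) t) := by
  set 𝒟 := (Icc 1 D₀).filter Squarefree with h𝒟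
  set T := Nat.primesLE ⌊x⌋₊ with hT
  set TG : ℕ → ℝ := fun d => ∑ L ∈ T.powerset with ¬(∏ p ∈ L, p) ≤ Λ,
    A.density (Nat.lcm d ((∏ p ∈ L, p) ^ 2)) with hTG
  set RS : ℕ → ℝ := fun d => ∑ L ∈ T.powerset with (∏ p ∈ L, p) ≤ Λ,
    |A.remainder (Nat.lcm d ((∏ p ∈ L, p) ^ 2)) t| with hRS
  set ES : ℕ → ℝ := fun d => ∑ L ∈ T.powerset with ¬(∏ p ∈ L, p) ≤ Λ,
    A.congrSum (Nat.lcm d ((∏ p ∈ L, p) ^ 2)) t with hES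
  set Gs := ∑ d ∈ 𝒟, moebiusSqDensity A.density d with hGs
  have hTp : ∀ p ∈ T, p.Prime := fun p hp => Nat.prime_of_mem_primesLE hp
  have hAt := A.congrSum_nonneg 1 t
  have hTG0 : ∀ d ∈ 𝒟, 0 ≤ TG d := fun d hd => Finset.sum_nonneg fun L hL =>
    density_lcm_sq_nonneg A.density_mult h24 (Finset.mem_filter.mp hd).2
      fun p hp => hTp p (Finset.mem_powerset.mp (Finset.mem_filter.mp hL).1 hp)
  have hRS0 : ∀ d, 0 ≤ RS d := fun d => Finset.sum_nonneg fun L _ => abs_nonneg _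
  have hES0 : ∀ d, 0 ≤ ES d := fun d => Finset.sum_nonneg fun L _ => A.congrSum_nonneg _ _
  have hgt0 : ∀ d, 0 ≤ moebiusSqDensity A.density d := moebiusSqDensity_nonneg A.density_mult h24
  have h1mem : (1 : ℕ) ∈ 𝒟 := Finset.mem_filter.mpr ⟨Finset.mem_Icc.mpr ⟨le_rfl, hD₀1⟩, squarefree_one⟩
  -- the pointwise bound, summed
  have hpt : ∀ d ∈ 𝒟, |A.moebiusSq.remainder d t| ≤
      (A.congrSum 1 t * TG d + RS d + ES d) +
        moebiusSqDensity A.density d * (A.congrSum 1 t * TG 1 + RS 1 + ES 1) := by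
    intro d hd
    have hd' := Finset.mem_filter.mp hd
    exact A.abs_moebiusSq_remainder_le hsize h24 hd'.2 ((Finset.mem_Icc.mp hd'.1).2.trans hD₀X) hx htx Λ
  have hE1 : A.congrSum 1 t * TG 1 + RS 1 + ES 1 ≤
      A.congrSum 1 t * ∑ d ∈ 𝒟, TG d + ∑ d ∈ 𝒟, RS d + ∑ d ∈ 𝒟, ES d := by
    refine add_le_add (add_le_add (mul_le_mul_of_nonneg_left ?_ hAt) ?_) ?_
    · exact Finset.single_le_sum hTG0 h1mem
    · exact Finset.single_le_sum (fun d _ => hRS0 d) h1mem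
    · exact Finset.single_le_sum (fun d _ => hES0 d) h1mem
  have hE0 : 0 ≤ A.congrSum 1 t * ∑ d ∈ 𝒟, TG d + ∑ d ∈ 𝒟, RS d + ∑ d ∈ 𝒟, ES d :=
    add_nonneg (add_nonneg (mul_nonneg hAt (Finset.sum_nonneg hTG0))
      (Finset.sum_nonneg fun d _ => hRS0 d)) (Finset.sum_nonneg fun d _ => hES0 d)
  calc ∑ d ∈ 𝒟, |A.moebiusSq.remainder d t|
      ≤ ∑ d ∈ 𝒟, ((A.congrSum 1 t * TG d + RS d + ES d) +
          moebiusSqDensity A.density d * (A.congrSum 1 t * TG 1 + RS 1 + ES 1)) :=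
        Finset.sum_le_sum hpt
    _ = (A.congrSum 1 t * ∑ d ∈ 𝒟, TG d + ∑ d ∈ 𝒟, RS d + ∑ d ∈ 𝒟, ES d) +
          Gs * (A.congrSum 1 t * TG 1 + RS 1 + ES 1) := by
        rw [Finset.sum_add_distrib, Finset.sum_add_distrib, Finset.sum_add_distrib, ← Finset.mul_sum,
          ← Finset.sum_mul]
    _ ≤ (A.congrSum 1 t * ∑ d ∈ 𝒟, TG d + ∑ d ∈ 𝒟, RS d + ∑ d ∈ 𝒟, ES d) +
          Gs * (A.congrSum 1 t * ∑ d ∈ 𝒟, TG d + ∑ d ∈ 𝒟, RS d + ∑ d ∈ 𝒟, ES d) :=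
        add_le_add_right (mul_le_mul_of_nonneg_left hE1 (Finset.sum_nonneg fun d _ => hgt0 d)) _
    _ = (1 + Gs) * (A.congrSum 1 t * ∑ d ∈ 𝒟, TG d + ∑ d ∈ 𝒟, RS d + ∑ d ∈ 𝒟, ES d) := by ring

/-- **Towards (9.12)**: `|Ã(t) - G_X A_1(t)| ≤ A_1(t) ∑_d TG_d + ∑_d RS_d(t) + ∑_d ES_d(t)`
(`G_X = ∏_{p ≤ ⌊x⌋} (1 - g(p²))`; the `d = 1` term of the decomposition, `1 ∈ 𝒟`).
[cite: FriedlanderIwaniecASP1998, (9.10) and (9.12)] -/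
theorem moebiusSq_size_sub_le_struct (hsize : ∀ t, A.size t = A.congrSum 1 t)
    (h24 : ∀ p : ℕ, p.Prime → 0 ≤ A.density (p ^ 2) ∧ A.density (p ^ 2) ≤ A.density p ∧
      A.density p < 1)
    {x t : ℝ} (hx : 1 ≤ x) (htx : t ≤ x) {D₀ : ℕ} (hD₀1 : 1 ≤ D₀) (Λ : ℕ) :
    |A.moebiusSq.size t - sqProd A.density ⌊x⌋₊ * A.congrSum 1 t| ≤
      A.congrSum 1 t * ∑ d ∈ (Icc 1 D₀).filter Squarefree,
          ∑ L ∈ (Nat.primesLE ⌊x⌋₊).powerset with ¬(∏ p ∈ L, p) ≤ Λ,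
            A.density (Nat.lcm d ((∏ p ∈ L, p) ^ 2)) +
        ∑ d ∈ (Icc 1 D₀).filter Squarefree,
          ∑ L ∈ (Nat.primesLE ⌊x⌋₊).powerset with (∏ p ∈ L, p) ≤ Λ,
            |A.remainder (Nat.lcm d ((∏ p ∈ L, p) ^ 2)) t| +
        ∑ d ∈ (Icc 1 D₀).filter Squarefree,
          ∑ L ∈ (Nat.primesLE ⌊x⌋₊).powerset with ¬(∏ p ∈ L, p) ≤ Λ,
            A.congrSum (Nat.lcm d ((∏ p ∈ L, p) ^ 2)) t := by
  set 𝒟 := (Icc 1 D₀).filter Squarefree with h𝒟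
  set T := Nat.primesLE ⌊x⌋₊ with hT
  have hTp : ∀ p ∈ T, p.Prime := fun p hp => Nat.prime_of_mem_primesLE hp
  have hAt := A.congrSum_nonneg 1 t
  have h1x : 1 ≤ ⌊x⌋₊ := Nat.le_floor (by simpa using hx)
  have h1mem : (1 : ℕ) ∈ 𝒟 := Finset.mem_filter.mpr ⟨Finset.mem_Icc.mpr ⟨le_rfl, hD₀1⟩, squarefree_one⟩
  have h1 := A.abs_moebiusSq_congrSum_sub_main_le hsize h24 squarefree_one h1x htx Λ
  rw [(isMultiplicative_moebiusSqDensity A.density).map_one, one_mul] at h1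
  rw [moebiusSq_size_eq]
  refine h1.trans (add_le_add (add_le_add (mul_le_mul_of_nonneg_left ?_ hAt) ?_) ?_)
  · refine Finset.single_le_sum (f := fun d => ∑ L ∈ T.powerset with ¬(∏ p ∈ L, p) ≤ Λ,
      A.density (Nat.lcm d ((∏ p ∈ L, p) ^ 2))) (fun d hd => ?_) h1mem
    exact Finset.sum_nonneg fun L hL => density_lcm_sq_nonneg A.density_mult h24
      (Finset.mem_filter.mp hd).2 fun p hp => hTp p (Finset.mem_powerset.mp (Finset.mem_filter.mp hL).1 hp)
  · exact Finset.single_le_sum (f := fun d => ∑ L ∈ T.powerset with (∏ p ∈ L, p) ≤ Λ,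
      |A.remainder (Nat.lcm d ((∏ p ∈ L, p) ^ 2)) t|)
      (fun d _ => Finset.sum_nonneg fun L _ => abs_nonneg _) h1mem
  · exact Finset.single_le_sum (f := fun d => ∑ L ∈ T.powerset with ¬(∏ p ∈ L, p) ≤ Λ,
      A.congrSum (Nat.lcm d ((∏ p ∈ L, p) ^ 2)) t)
      (fun d _ => Finset.sum_nonneg fun L _ => A.congrSum_nonneg _ _) h1mem

/-- The weighted sums are non-decreasing in the range: `W_t(m) ≤ W_x(m)` for `t ≤ x`. [folklore] -/
theorem weighted_mono {t x : ℝ} (htx : t ≤ x) (m : ℕ) :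
    ∑ n ∈ (Ioc 0 ⌊t⌋₊).filter (m ∣ ·), A.a n * (2 : ℝ) ^ n.primeFactors.card ≤
      ∑ n ∈ (Ioc 0 ⌊x⌋₊).filter (m ∣ ·), A.a n * (2 : ℝ) ^ n.primeFactors.card := by
  refine Finset.sum_le_sum_of_subset_of_nonneg (Finset.filter_subset_filter _ ?_)
    fun n _ _ => mul_nonneg (A.a_nonneg n) (by positivity)
  exact Finset.Ioc_subset_Ioc_right (Nat.floor_mono htx)

/-- **The bound for `E(t)`** (FI pp. 1061–1062: `E₁` by the level hypothesis, `E₂₁` by (9.2) and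
divisor sums, `E₂₂² ≤ S₁S₂`, `S₁` by Rankin and the level hypothesis; the density tail likewise): for
`x ≥ 1`, `t ≤ x`, `1 ≤ Λ`, `1 ≤ Λ₁`, `D₀Λ² ≤ M`, `Λ₁² ≤ M`, squarefree `d ≤ D₀`, under `size_eq`, (2.4)
and (2.6) `g(p²) ≤ K/p²`, and with `V ≥ ∑_{m ≤ ⌊t⌋} τ(m)³/m`:
`E(t) ≤ A(x)·(e^{2KC}/Λ^{3/4})·e^{∑_{p≤D₀} g(p)} + √((M₄ + A(x)E_g)·R(t))`
`+ √((A(x) e^{KC}/Λ^{3/4} + R(x))·M₃) + √((∑_{n≤t} a_n²)·(⌊t⌋V²/Λ₁))`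
in the notation of the module docstring. [cite: FriedlanderIwaniecASP1998, §9 pp. 1061-1062] -/
theorem moebiusSq_E_le (hsize : ∀ t, A.size t = A.congrSum 1 t)
    (h24 : ∀ p : ℕ, p.Prime → 0 ≤ A.density (p ^ 2) ∧ A.density (p ^ 2) ≤ A.density p ∧
      A.density p < 1)
    {K : ℝ} (h26 : ∀ p : ℕ, p.Prime → A.density (p ^ 2) ≤ K / (p : ℝ) ^ 2)
    {x t : ℝ} (htx : t ≤ x) {D₀ Λ Λ₁ M : ℕ} (hΛ : 1 ≤ Λ) (hΛ₁ : 1 ≤ Λ₁)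
    (hM : D₀ * Λ ^ 2 ≤ M) (hM₁ : Λ₁ ^ 2 ≤ M) {V : ℝ}
    (hV : ∑ m ∈ Icc 1 ⌊t⌋₊, (σ 0 m : ℝ) ^ 3 / m ≤ V) :
    A.congrSum 1 t * ∑ d ∈ (Icc 1 D₀).filter Squarefree,
        ∑ L ∈ (Nat.primesLE ⌊x⌋₊).powerset with ¬(∏ p ∈ L, p) ≤ Λ,
          A.density (Nat.lcm d ((∏ p ∈ L, p) ^ 2)) +
      ∑ d ∈ (Icc 1 D₀).filter Squarefree,
        ∑ L ∈ (Nat.primesLE ⌊x⌋₊).powerset with (∏ p ∈ L, p) ≤ Λ,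
          |A.remainder (Nat.lcm d ((∏ p ∈ L, p) ^ 2)) t| +
      ∑ d ∈ (Icc 1 D₀).filter Squarefree,
        ∑ L ∈ (Nat.primesLE ⌊x⌋₊).powerset with ¬(∏ p ∈ L, p) ≤ Λ,
          A.congrSum (Nat.lcm d ((∏ p ∈ L, p) ^ 2)) t ≤
      A.congrSum 1 x * (Real.exp (2 * K * ∑' n : ℕ, (n : ℝ) ^ (-(5 / 4 : ℝ))) / (Λ : ℝ) ^ (3 / 4 : ℝ) *
          Real.exp (∑ p ∈ Nat.primesLE D₀, A.density p)) +
      Real.sqrt ((∑ n ∈ Ioc 0 ⌊x⌋₊, A.a n * (2 : ℝ) ^ (4 * n.primeFactors.card) +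
          A.congrSum 1 x * ∑ b ∈ (Icc 1 M).filter IsCubefree, (4 : ℝ) ^ b.primeFactors.card * A.density b) *
        ∑ b ∈ (Icc 1 M).filter IsCubefree, |A.remainder b t|) +
      Real.sqrt ((A.congrSum 1 x * (Real.exp (K * ∑' n : ℕ, (n : ℝ) ^ (-(5 / 4 : ℝ))) /
            (Λ : ℝ) ^ (3 / 4 : ℝ)) + ∑ b ∈ (Icc 1 M).filter IsCubefree, |A.remainder b x|) *
        ∑ n ∈ Ioc 0 ⌊x⌋₊, A.a n * (2 : ℝ) ^ (3 * n.primeFactors.card)) +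
      Real.sqrt ((∑ n ∈ Ioc 0 ⌊t⌋₊, A.a n ^ 2) * (⌊t⌋₊ * V ^ 2 / Λ₁)) := by
  set 𝒟 := (Icc 1 D₀).filter Squarefree with h𝒟
  set T := Nat.primesLE ⌊x⌋₊ with hT
  set ℬ := (Icc 1 M).filter IsCubefree with hℬ
  have hTp : ∀ p ∈ T, p.Prime := fun p hp => Nat.prime_of_mem_primesLE hp
  have h𝒟sq : ∀ d ∈ 𝒟, Squarefree d := fun d hd => (Finset.mem_filter.mp hd).2
  have hℬc : ∀ b ∈ ℬ, IsCubefree b := fun b hb => (Finset.mem_filter.mp hb).2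
  have hAt := A.congrSum_nonneg 1 t
  have hAx := A.congrSum_nonneg 1 x
  have hAtx : A.congrSum 1 t ≤ A.congrSum 1 x := A.congrSum_mono 1 htx
  refine le_trans (add_le_add (add_le_add ?_ ?_) ?_) (le_of_eq (add_assoc _ _ _).symm)
  · -- the density tail
    have h := A.sum_sum_big_density_lcm_le h24 h26 hTp hΛ D₀
    have h' := A.sum_squarefree_density_le_exp h24 D₀
    have hpos : 0 ≤ Real.exp (2 * K * ∑' n : ℕ, (n : ℝ) ^ (-(5 / 4 : ℝ))) / (Λ : ℝ) ^ (3 / 4 : ℝ) :=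
      by positivity
    calc A.congrSum 1 t * ∑ d ∈ 𝒟, ∑ L ∈ T.powerset with ¬(∏ p ∈ L, p) ≤ Λ,
          A.density (Nat.lcm d ((∏ p ∈ L, p) ^ 2))
        ≤ A.congrSum 1 x * (Real.exp (2 * K * ∑' n : ℕ, (n : ℝ) ^ (-(5 / 4 : ℝ))) /
            (Λ : ℝ) ^ (3 / 4 : ℝ) * ∑ d ∈ 𝒟, A.density d) :=
          mul_le_mul hAtx h (Finset.sum_nonneg fun d hd => Finset.sum_nonneg fun L hL =>
            density_lcm_sq_nonneg A.density_mult h24 (h𝒟sq d hd)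
              fun p hp => hTp p (Finset.mem_powerset.mp (Finset.mem_filter.mp hL).1 hp)) hAx
      _ ≤ _ := mul_le_mul_of_nonneg_left (mul_le_mul_of_nonneg_left h' hpos) hAx
  · -- the remainders `RS`
    have h1 := A.sum_sum_small_abs_remainder_le_weighted hTp t hM (D₀ := D₀)
    refine h1.trans (Real.le_sqrt_of_sq_le ?_)
    refine (A.sq_sum_two_pow_abs_remainder_le ℬ t).trans ?_
    exact mul_le_mul_of_nonneg_right (A.sum_four_pow_abs_remainder_le hsize h24 ℬ hℬc htx)
      (Finset.sum_nonneg fun b _ => abs_nonneg _)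
  · -- the large-square part `ES`: split the range of `ℓ` at `Λ₁`
    have h1 := A.sum_sum_big_congrSum_lcm_le hTp Λ t 𝒟 h𝒟sq
    refine h1.trans ?_
    set W : ℕ → ℝ := fun l => ∑ n ∈ (Ioc 0 ⌊t⌋₊).filter (l ^ 2 ∣ ·),
      A.a n * (2 : ℝ) ^ n.primeFactors.card with hW
    have hW0 : ∀ l, 0 ≤ W l := fun l => Finset.sum_nonneg fun n _ =>
      mul_nonneg (A.a_nonneg n) (by positivity)
    have hsplit : (Ioc Λ (Nat.sqrt ⌊t⌋₊)).filter Squarefree ⊆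
        (Ioc Λ Λ₁).filter Squarefree ∪ (Ioc Λ₁ (Nat.sqrt ⌊t⌋₊)).filter Squarefree := by
      intro l hl
      have hl' := Finset.mem_filter.mp hl
      have hl1 := Finset.mem_Ioc.mp hl'.1
      rcases le_or_gt l Λ₁ with h | h
      · exact Finset.mem_union_left _ (Finset.mem_filter.mpr ⟨Finset.mem_Ioc.mpr ⟨hl1.1, h⟩, hl'.2⟩)
      · exact Finset.mem_union_right _ (Finset.mem_filter.mpr ⟨Finset.mem_Ioc.mpr ⟨h, hl1.2⟩, hl'.2⟩)
    change ∑ l ∈ (Ioc Λ (Nat.sqrt ⌊t⌋₊)).filter Squarefree, W l ≤ _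
    calc ∑ l ∈ (Ioc Λ (Nat.sqrt ⌊t⌋₊)).filter Squarefree, W l
        ≤ ∑ l ∈ (Ioc Λ Λ₁).filter Squarefree ∪ (Ioc Λ₁ (Nat.sqrt ⌊t⌋₊)).filter Squarefree, W l :=
          Finset.sum_le_sum_of_subset_of_nonneg hsplit fun l _ _ => hW0 l
      _ ≤ ∑ l ∈ (Ioc Λ Λ₁).filter Squarefree, W l +
            ∑ l ∈ (Ioc Λ₁ (Nat.sqrt ⌊t⌋₊)).filter Squarefree, W l := by
          rw [← Finset.sum_union_inter]
          linarith [Finset.sum_nonneg (s := (Ioc Λ Λ₁).filter Squarefree ∩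
            (Ioc Λ₁ (Nat.sqrt ⌊t⌋₊)).filter Squarefree) fun l _ => hW0 l]
      _ ≤ _ := add_le_add ?_ ?_
    · -- `Λ < ℓ ≤ Λ₁`: pass to `x`, Cauchy–Schwarz against `S₁`, Rankin
      have hS : ∀ l ∈ (Ioc Λ Λ₁).filter Squarefree, Squarefree l := fun l hl => (Finset.mem_filter.mp hl).2
      calc ∑ l ∈ (Ioc Λ Λ₁).filter Squarefree, W l
          ≤ ∑ l ∈ (Ioc Λ Λ₁).filter Squarefree, ∑ n ∈ (Ioc 0 ⌊x⌋₊).filter (l ^ 2 ∣ ·),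
              A.a n * (2 : ℝ) ^ n.primeFactors.card :=
            Finset.sum_le_sum fun l _ => A.weighted_mono htx (l ^ 2)
        _ ≤ _ := by
            refine Real.le_sqrt_of_sq_le ?_
            refine (A.sq_sum_weighted_le_sum_congrSum_mul _ hS x).trans ?_
            exact mul_le_mul_of_nonneg_right (A.sum_mid_congrSum_sq_le_rankin hsize h24 h26 hΛ hM₁ x)
              (Finset.sum_nonneg fun n _ => mul_nonneg (A.a_nonneg n) (by positivity))
    · -- `ℓ > Λ₁`: Cauchy–Schwarz against `∑ a_n²` and the divisor sums
      have hS : ∀ l ∈ (Ioc Λ₁ (Nat.sqrt ⌊t⌋₊)).filter Squarefree, Squarefree l :=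
        fun l hl => (Finset.mem_filter.mp hl).2
      refine Real.le_sqrt_of_sq_le ?_
      refine (A.sq_sum_weighted_le_sum_sq_mul _ hS t).trans ?_
      exact mul_le_mul_of_nonneg_left (sum_eight_pow_mul_card_le hΛ₁ hV)
        (Finset.sum_nonneg fun n _ => sq_nonneg _)

end SieveSequence

end Literature.NumberTheory.Sieve
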